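import Summits.AtomisticToContinuum.Crystallization.Theorems.FreeSplittingCertificatesStrictSplittingRulePolytypeLedgerDefs

/-!
# `StrictSplittingRule` (stmt-AtomisticToContinuum-12560), line `polytype`: the zeroth-order stacking ledger (abstract form)

The abstract 1-D theorem behind stub `stub_stackingLedger` (Z) of line `polytype`: for a coupling sequence `J : ℕ → ℝ`
with `J_k ≤ 0` (`k ≥ 2`), `J₂ < 0`, `Σ k|J_k| < ∞` and Hägg half-domination `Σ_{k≥3}(k−1)|J_k| ≤ ½|J₂|`, the ledger
`HaggLedger J` of `…PolytypeLedgerDefs.lean` holds: on every Hägg sequence every layer's forward and backward balances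
are non-negative (`haggLedger_of_domination`).

Proof.  If no layer above `m` is c-type the sequence alternates above `m`, `aligned(m,k) ↔ k even` for all `k`, and the
forward anomaly vanishes.  Otherwise let `n ≥ 1` be the distance to the FIRST c-layer above: `aligned(m,k) ↔ k even` for
`k ≤ n`, the window at `k = n+1` is `2·s m` or `−s m` (never `≡ 0 mod 3`), so the term at `n+1` is `−[n+1 even]·J_{n+1} ≥ 0`
(`= |J₂|` when `n = 1`), and every later term is `≥ −|J_k|`: anomaly `≥ ½ term_{n+1} − ledgerPay J n`.  For `n ≥ 2` the
layer books `ledgerPay J n`: balance `≥ 0`.  For `n = 1` it is a bank: balance `≥ ½|J₂| − ½Σ_{k≥3}(k−1)|J_k| − |J₂|/8 ≥ ⅛|J₂|`.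
Backward balance = forward balance of the reflected sequence `i ↦ s(2m−1−i)` at the same layer.  All [folklore].
-/

noncomputable section

namespace Summit.AtomisticToContinuum.Crystallization.Theorems.StrictSplittingRuleBirth

open scoped BigOperators Classical
open Finset
open Literature.MathematicalPhysics.StatisticalMechanics

/-! ## §1  Summability bookkeeping -/

/-- `Σ k|J_k| < ∞ ⇒ Σ |J_k| < ∞`. [folklore] -/
theorem ledger_summable_abs {J : ℕ → ℝ} (hsum : Summable fun k : ℕ => (k : ℝ) * |J k|) :
    Summable fun k : ℕ => |J k| := by
  have hfin : Summable fun k : ℕ => if k = 0 then |J 0| else (0 : ℝ) :=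
    summable_of_ne_finset_zero (s := {0}) (by intro k hk; rw [Finset.mem_singleton] at hk; simp [hk])
  refine Summable.of_nonneg_of_le (fun k => abs_nonneg _) (fun k => ?_) (hsum.add hfin)
  rcases Nat.eq_zero_or_pos k with rfl | hk
  · simp
  · have hk' : (1 : ℝ) ≤ k := by exact_mod_cast hk
    have h0 : 0 ≤ |J k| := abs_nonneg _
    rw [if_neg hk.ne']
    nlinarith

/-- A masked absolutely summable sequence is summable. [folklore] -/
theorem ledger_summable_ite {J : ℕ → ℝ} (hJ : Summable fun k : ℕ => |J k|) (P : ℕ → Prop) [DecidablePred P] :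
    Summable fun k => if P k then J k else 0 :=
  Summable.of_norm_bounded hJ fun k => by
    by_cases hk : P k <;> simp [hk]

/-- A masked, re-weighted summable non-negative sequence is summable: `Σ k|J_k| < ∞ ⇒ Σ_{P k} (k − c)|J_k| < ∞` for the
weights used by the ledger (`|k − c| ≤ k + |c|`). [folklore] -/
theorem ledger_summable_weight {J : ℕ → ℝ} (hsum : Summable fun k : ℕ => (k : ℝ) * |J k|) (c : ℝ) (P : ℕ → Prop)
    [DecidablePred P] : Summable fun k : ℕ => if P k then ((k : ℝ) - c) * |J k| else 0 := by
  have habs := ledger_summable_abs hsum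
  refine Summable.of_norm_bounded (hsum.add (habs.mul_left |c|)) fun k => ?_
  by_cases hk : P k
  · rw [if_pos hk, Real.norm_eq_abs, abs_mul, abs_abs]
    have h0 : 0 ≤ |J k| := abs_nonneg _
    have h1 : |(k : ℝ) - c| ≤ k + |c| := by
      calc |(k : ℝ) - c| ≤ |(k : ℝ)| + |c| := abs_sub _ _
        _ = k + |c| := by rw [Nat.abs_cast]
    calc |(k : ℝ) - c| * |J k| ≤ ((k : ℝ) + |c|) * |J k| := mul_le_mul_of_nonneg_right h1 h0
      _ = (k : ℝ) * |J k| + |c| * |J k| := by ring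
  · rw [if_neg hk, norm_zero]
    positivity

/-! ## §2  Word combinatorics: alternation below the first c-layer -/

section Words

variable {s : ℤ → ℤ}

/-- Where the Hägg sequence is not c-type it flips. [folklore] -/
theorem hagg_eq_neg_of_not_isCLayer (hs : IsHaggSeq s) {L : ℤ} (h : ¬ IsCLayer s L) : s L = -s (L - 1) := by
  unfold IsCLayer at h
  rcases hs L with h1 | h1 <;> rcases hs (L - 1) with h2 | h2 <;> simp_all

/-- Values of an alternating stretch: if no layer `m + d`, `1 ≤ d ≤ n`, is c-type then `s (m + k) = (−1)^k s m` for
`k ≤ n`. [folklore] -/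
theorem hagg_alt_values (hs : IsHaggSeq s) {m : ℤ} {n : ℕ}
    (halt : ∀ d : ℕ, 1 ≤ d → d ≤ n → ¬ IsCLayer s (m + d)) :
    ∀ k : ℕ, k ≤ n → s (m + k) = if Even k then s m else -s m := by
  intro k
  induction k with
  | zero => intro; simp
  | succ k ih =>
    intro hk
    have h1 := hagg_eq_neg_of_not_isCLayer hs (halt (k + 1) (by omega) hk)
    have h2 := ih (by omega)
    have e : (m + ((k + 1 : ℕ) : ℤ)) - 1 = m + (k : ℤ) := by push_cast; ring
    rw [e] at h1
    rw [h1, h2]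
    by_cases he : Even k
    · have : ¬ Even (k + 1) := by rw [Nat.even_add_one]; exact not_not.2 he
      simp [he, this]
    · have : Even (k + 1) := by rw [Nat.even_add_one]; exact he
      simp [he, this]

/-- Windows of an alternating stretch: `0` at even length, `s m` at odd length, up to length `n + 1`. [folklore] -/
theorem hagg_alt_window (hs : IsHaggSeq s) {m : ℤ} {n : ℕ}
    (halt : ∀ d : ℕ, 1 ≤ d → d ≤ n → ¬ IsCLayer s (m + d)) :
    ∀ k : ℕ, k ≤ n + 1 → haggWindow s m k = if Even k then 0 else s m := by
  intro k
  induction k with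
  | zero => intro; simp
  | succ k ih =>
    intro hk
    rw [haggWindow_succ, ih (by omega), hagg_alt_values hs halt k (by omega)]
    by_cases he : Even k
    · have : ¬ Even (k + 1) := by rw [Nat.even_add_one]; exact not_not.2 he
      simp [he, this]
    · have : Even (k + 1) := by rw [Nat.even_add_one]; exact he
      simp [he, this]

/-- On an alternating stretch alignment is parity: `aligned(m, k) ↔ k even` for `k ≤ n + 1`. [folklore] -/
theorem hagg_alt_aligned_iff (hs : IsHaggSeq s) {m : ℤ} {n : ℕ}
    (halt : ∀ d : ℕ, 1 ≤ d → d ≤ n → ¬ IsCLayer s (m + d)) {k : ℕ} (hk : k ≤ n + 1) :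
    HaggAligned s m k ↔ Even k := by
  unfold HaggAligned
  rw [hagg_alt_window hs halt k hk]
  by_cases he : Even k
  · simp [he]
  · simp only [he, if_false, iff_false]
    rcases hs m with h1 | h1 <;> rw [h1] <;> decide

/-- **The first anomaly is never a deficit.**  If `m + n` (`n ≥ 1`) is the first c-layer above `m`, the layers `m` and
`m + n + 1` are NOT aligned (the window is `2·s m` or `−s m`). [folklore] -/
theorem hagg_not_aligned_first (hs : IsHaggSeq s) {m : ℤ} {n : ℕ} (hn : 1 ≤ n) (hc : IsCLayer s (m + n))
    (halt : ∀ d : ℕ, 1 ≤ d → d < n → ¬ IsCLayer s (m + d)) : ¬ HaggAligned s m (n + 1) := by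
  have halt' : ∀ d : ℕ, 1 ≤ d → d ≤ n - 1 → ¬ IsCLayer s (m + d) := fun d h1 h2 => halt d h1 (by omega)
  have hw : haggWindow s m n = if Even n then 0 else s m := hagg_alt_window hs halt' n (by omega)
  have hv : s (m + ((n - 1 : ℕ) : ℤ)) = if Even (n - 1) then s m else -s m := hagg_alt_values hs halt' (n - 1) le_rfl
  have hcn : s (m + (n : ℤ)) = s (m + ((n - 1 : ℕ) : ℤ)) := by
    unfold IsCLayer at hc
    rw [← hc]
    congr 1
    push_cast [Nat.cast_sub hn]
    ring
  unfold HaggAligned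
  rw [haggWindow_succ, hw, hcn, hv]
  by_cases he : Even n
  · have hne : ¬ Even (n - 1) := by
      intro h'
      have := Nat.even_add.1 (show Even (n - 1 + 1) by rw [Nat.sub_add_cancel hn]; exact he)
      exact absurd (this.1 h') (by decide)
    simp only [he, hne, if_true, if_false, zero_add]
    rcases hs m with h1 | h1 <;> rw [h1] <;> decide
  · have hne : Even (n - 1) := by
      rcases Nat.even_or_odd (n - 1) with h' | h'
      · exact h'
      · exfalso; apply he
        have : n = n - 1 + 1 := (Nat.sub_add_cancel hn).symm
        rw [this]; exact h'.add_one
    simp only [he, hne, if_true, if_false]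
    rcases hs m with h1 | h1 <;> rw [h1] <;> decide

end Words

/-! ## §3  The forward balance -/

section Forward

variable {J : ℕ → ℝ} {s : ℤ → ℤ}

/-- The forward anomaly term by term. [folklore] -/
theorem ledger_anomaly_eq (hJ : Summable fun k : ℕ => |J k|) (s : ℤ → ℤ) (m : ℤ) :
    haggLocalEnergy J s m - hcpHalfRef J =
      ∑' k : ℕ, ((if 2 ≤ k ∧ HaggAligned s m k then J k else 0) - (if 2 ≤ k ∧ Even k then J k else 0)) := by
  unfold haggLocalEnergy hcpHalfRef
  exact (Summable.tsum_sub (ledger_summable_ite hJ (fun k => 2 ≤ k ∧ HaggAligned s m k))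
    (ledger_summable_ite hJ (fun k => 2 ≤ k ∧ Even k))).symm

/-- Every anomaly term is `≥ −|J_k|`. [folklore] -/
theorem ledger_term_ge (J : ℕ → ℝ) (s : ℤ → ℤ) (m : ℤ) (k : ℕ) :
    -|J k| ≤ (if 2 ≤ k ∧ HaggAligned s m k then J k else 0) - (if 2 ≤ k ∧ Even k then J k else 0) := by
  have h1 := neg_abs_le (J k)
  have h2 := le_abs_self (J k)
  split_ifs <;> linarith

/-- `2 · ledgerPay J n = Σ_{k ≥ n+2} |J_k|` as the sum of the masked sequence. [folklore] -/
theorem ledger_two_mul_ledgerPay (J : ℕ → ℝ) (n : ℕ) :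
    2 * ledgerPay J n = ∑' k : ℕ, if n + 2 ≤ k then |J k| else 0 := by
  unfold ledgerPay; ring

/-- **The forward anomaly below the first c-layer.**  If `m + n` (`n ≥ 1`) is the first c-layer above `m`, then
`haggLocalEnergy − hcpHalfRef ≥ −[n+1 even]·J_{n+1} − 2·ledgerPay J n` (no anomaly up to `n`, a surplus or nothing at
`n + 1`, at worst `−|J_k|` beyond). [folklore] -/
theorem ledger_anomaly_ge_first (hJ : Summable fun k : ℕ => |J k|)
    (hs : IsHaggSeq s) {m : ℤ} {n : ℕ} (hn : 1 ≤ n) (hc : IsCLayer s (m + n))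
    (halt : ∀ d : ℕ, 1 ≤ d → d < n → ¬ IsCLayer s (m + d)) :
    -(if Even (n + 1) then J (n + 1) else 0) - 2 * ledgerPay J n ≤ haggLocalEnergy J s m - hcpHalfRef J := by
  rw [ledger_anomaly_eq hJ, ledger_two_mul_ledgerPay]
  -- termwise minorant
  set f : ℕ → ℝ := fun k =>
    (if k = n + 1 then -(if Even (n + 1) then J (n + 1) else 0) else 0) + (if n + 2 ≤ k then -|J k| else 0) with hf
  have hsingle : Summable fun k : ℕ => if k = n + 1 then -(if Even (n + 1) then J (n + 1) else 0) else (0 : ℝ) :=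
    summable_of_ne_finset_zero (s := {n + 1}) (by intro k hk; rw [Finset.mem_singleton] at hk; simp [hk])
  have htail : Summable fun k : ℕ => if n + 2 ≤ k then -|J k| else (0 : ℝ) :=
    Summable.of_norm_bounded hJ fun k => by by_cases hk : n + 2 ≤ k <;> simp [hk]
  have hfsum : Summable f := hsingle.add htail
  have hfval : ∑' k, f k = -(if Even (n + 1) then J (n + 1) else 0) - ∑' k : ℕ, (if n + 2 ≤ k then |J k| else 0) := by
    rw [hf, Summable.tsum_add hsingle htail, tsum_ite_eq, sub_eq_add_neg, ← tsum_neg]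
    congr 1
    exact tsum_congr fun k => by by_cases hk : n + 2 ≤ k <;> simp [hk]
  rw [← hfval]
  refine Summable.tsum_le_tsum (fun k => ?_) hfsum ((ledger_summable_ite hJ _).sub (ledger_summable_ite hJ _))
  -- the termwise inequality
  have halt' : ∀ d : ℕ, 1 ≤ d → d ≤ n - 1 → ¬ IsCLayer s (m + d) := fun d h1 h2 => halt d h1 (by omega)
  simp only [hf]
  rcases lt_trichotomy k (n + 1) with hk | rfl | hk
  · -- no anomaly up to `n`
    have hiff : HaggAligned s m k ↔ Even k := hagg_alt_aligned_iff hs halt' (by omega)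
    rw [if_neg (by omega : k ≠ n + 1), if_neg (by omega : ¬ n + 2 ≤ k), add_zero]
    by_cases h2k : 2 ≤ k
    · by_cases he : Even k
      · rw [if_pos ⟨h2k, hiff.2 he⟩, if_pos ⟨h2k, he⟩, sub_self]
      · rw [if_neg (fun h => he (hiff.1 h.2)), if_neg (fun h => he h.2), sub_self]
    · rw [if_neg (fun h => h2k h.1), if_neg (fun h => h2k h.1), sub_self]
  · -- the first possible anomaly is a surplus or nothing
    have hna : ¬ HaggAligned s m (n + 1) := hagg_not_aligned_first hs hn hc halt
    have hA : ¬ (2 ≤ n + 1 ∧ HaggAligned s m (n + 1)) := fun h => hna h.2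
    rw [if_neg hA, if_pos (rfl : n + 1 = n + 1), if_neg (show ¬ (n + 2 ≤ n + 1) by omega), add_zero, zero_sub]
    by_cases he : Even (n + 1)
    · rw [if_pos he, if_pos (show 2 ≤ n + 1 ∧ Even (n + 1) from ⟨by omega, he⟩)]
    · rw [if_neg he, if_neg (show ¬ (2 ≤ n + 1 ∧ Even (n + 1)) from fun h => he h.2)]
  · rw [if_neg (by omega : k ≠ n + 1), if_pos (by omega : n + 2 ≤ k), zero_add]
    exact ledger_term_ge J s m k

/-- **No c-layer above: no forward anomaly.** [folklore] -/
theorem ledger_anomaly_eq_zero_of_none (hJ : Summable fun k : ℕ => |J k|) (hs : IsHaggSeq s) {m : ℤ}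
    (hnone : ∀ d : ℕ, 1 ≤ d → ¬ IsCLayer s (m + d)) : haggLocalEnergy J s m - hcpHalfRef J = 0 := by
  rw [ledger_anomaly_eq hJ]
  refine (tsum_congr fun k => ?_).trans tsum_zero
  have hiff : HaggAligned s m k ↔ Even k :=
    hagg_alt_aligned_iff (n := k) hs (fun d h1 _ => hnone d h1) (by omega)
  simp only [hiff, sub_self]

/-- The bank's books WITHOUT domination: `ledgerPay J 1 + ledgerOutlay J ≤ ½ Σ_{k≥3}(k−1)|J_k|` (termwise:
`[k≥3] + [k≥4](k−3) ≤ [k≥3](k−1)`); any domination bound for the right-hand side can be plugged in. [folklore] -/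
theorem ledger_bank_sum_le (hsum : Summable fun k : ℕ => (k : ℝ) * |J k|) :
    ledgerPay J 1 + ledgerOutlay J ≤ 1 / 2 * ∑' k : ℕ, (if 3 ≤ k then ((k : ℝ) - 1) * |J k| else 0) := by
  have habs := ledger_summable_abs hsum
  have hA : Summable fun k : ℕ => if 1 + 2 ≤ k then |J k| else 0 := by
    refine Summable.of_norm_bounded habs fun k => ?_
    by_cases hk : 1 + 2 ≤ k <;> simp [hk]
  have hB := ledger_summable_weight hsum 3 (fun k => 4 ≤ k)
  have hC := ledger_summable_weight hsum 1 (fun k => 3 ≤ k)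
  have key : ∑' k : ℕ, (if 1 + 2 ≤ k then |J k| else 0) + ∑' k : ℕ, (if 4 ≤ k then ((k : ℝ) - 3) * |J k| else 0) ≤
      ∑' k : ℕ, (if 3 ≤ k then ((k : ℝ) - 1) * |J k| else 0) := by
    rw [← Summable.tsum_add hA hB]
    refine Summable.tsum_le_tsum (fun k => ?_) (hA.add hB) hC
    have h0 : 0 ≤ |J k| := abs_nonneg _
    by_cases h4 : 4 ≤ k
    · have h3 : 3 ≤ k := by omega
      have h3' : 1 + 2 ≤ k := by omega
      rw [if_pos h3', if_pos h4, if_pos h3]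
      nlinarith
    · by_cases h3 : 3 ≤ k
      · have h3' : 1 + 2 ≤ k := by omega
        have hk3 : (k : ℝ) = 3 := by exact_mod_cast (show k = 3 by omega)
        rw [if_pos h3', if_neg h4, if_pos h3, hk3]
        linarith
      · have h3' : ¬ 1 + 2 ≤ k := by omega
        rw [if_neg h3', if_neg h4, if_neg h3]; simp
  unfold ledgerPay ledgerOutlay
  linarith

/-- **A layer that is not a bank has non-negative forward balance** — no domination needed: either no c-layer lies
above it (no anomaly) or it books the payment of the bank of its first c-layer, at distance `n ≥ 2`. [folklore] -/
theorem fwdBalance_nonneg_of_not_bank (hneg : ∀ k, 2 ≤ k → J k ≤ 0) (habs : Summable fun k : ℕ => |J k|)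
    (hs : IsHaggSeq s) {m : ℤ} (hnb : ¬ IsCLayer s (m + 1)) : 0 ≤ fwdBalance J s m := by
  have hpay0 : ∀ d, 0 ≤ ledgerPay J d := fun d => by
    unfold ledgerPay
    exact mul_nonneg (by norm_num) (tsum_nonneg fun k => by split_ifs <;> simp [abs_nonneg])
  have hinc0 : 0 ≤ ∑' d : ℕ, (if 2 ≤ d ∧ IsFirstCAbove s m d then ledgerPay J d else 0) :=
    tsum_nonneg fun d => by split_ifs <;> simp [hpay0]
  unfold fwdBalance
  rw [if_neg hnb, sub_zero]
  by_cases hex : ∃ d : ℕ, 1 ≤ d ∧ IsCLayer s (m + d)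
  · -- `n ≥ 2` = distance to the first c-layer above; the layer books `ledgerPay J n`
    set n := Nat.find hex with hn
    have hn1 : 1 ≤ n := (Nat.find_spec hex).1
    have hc : IsCLayer s (m + n) := (Nat.find_spec hex).2
    have hmin : ∀ d : ℕ, 1 ≤ d → d < n → ¬ IsCLayer s (m + d) := fun d h1 h2 h3 =>
      Nat.find_min hex h2 ⟨h1, h3⟩
    have hge : 2 ≤ n := by
      rcases Nat.lt_or_ge n 2 with hlt | hge
      · exfalso
        have hn' : n = 1 := le_antisymm (by omega) hn1
        rw [hn'] at hc
        exact hnb (by exact_mod_cast hc)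
      · exact hge
    have hanom := ledger_anomaly_ge_first habs hs hn1 hc hmin
    have huniq : ∀ d : ℕ, 2 ≤ d ∧ IsFirstCAbove s m d → d = n := by
      rintro d ⟨h2d, hcd, hmind⟩
      by_contra hne
      rcases lt_or_gt_of_ne hne with hlt | hgt
      · exact hmin d (by omega) hlt hcd
      · exact hmind n hn1 hgt hc
    have hinc : ∑' d : ℕ, (if 2 ≤ d ∧ IsFirstCAbove s m d then ledgerPay J d else 0) = ledgerPay J n := by
      rw [tsum_eq_single n]
      · rw [if_pos ⟨hge, hc, hmin⟩]
      · intro d hd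
        rw [if_neg]
        exact fun h => hd (huniq d h)
    rw [hinc]
    have hterm : 0 ≤ -(if Even (n + 1) then J (n + 1) else 0) := by
      split_ifs
      · linarith [hneg (n + 1) (by omega)]
      · simp
    nlinarith [hanom, hterm, hpay0 n]
  · -- no c-layer above at all
    push Not at hex
    rw [ledger_anomaly_eq_zero_of_none habs hs (fun d h1 => hex d h1), mul_zero, zero_add]
    exact hinc0

/-- **The books of a bank** — no domination needed: the layer just below a c-layer retains
`½|J₂| − (ledgerPay J 1 + ledgerOutlay J) − |J₂|/8` (surplus `½|J₂|` at distance `2`, own deficits `≤ ledgerPay J 1`,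
outlay, donation); this is the explicit FIRST-ORDER BUDGET of the bank layers for the assembly. [folklore] -/
theorem fwdBalance_bank_ge (h2 : J 2 ≤ 0) (habs : Summable fun k : ℕ => |J k|) (hs : IsHaggSeq s) {m : ℤ}
    (hb : IsCLayer s (m + 1)) :
    |J 2| / 2 - (ledgerPay J 1 + ledgerOutlay J) - |J 2| / 8 ≤ fwdBalance J s m := by
  have hpay0 : ∀ d, 0 ≤ ledgerPay J d := fun d => by
    unfold ledgerPay
    exact mul_nonneg (by norm_num) (tsum_nonneg fun k => by split_ifs <;> simp [abs_nonneg])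
  have hinc0 : 0 ≤ ∑' d : ℕ, (if 2 ≤ d ∧ IsFirstCAbove s m d then ledgerPay J d else 0) :=
    tsum_nonneg fun d => by split_ifs <;> simp [hpay0]
  have hb' : IsCLayer s (m + ((1 : ℕ) : ℤ)) := by exact_mod_cast hb
  have hanom := ledger_anomaly_ge_first (n := 1) habs hs le_rfl hb' (fun d h1 h2 => by omega)
  have hif : (if Even (1 + 1) then J (1 + 1) else 0) = J 2 := by norm_num
  rw [hif] at hanom
  unfold fwdBalance
  rw [if_pos hb]
  have hJ2 : |J 2| = -J 2 := abs_of_nonpos h2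
  nlinarith [hinc0, hanom, hJ2]

/-- **The forward balance is non-negative** under Hägg half-domination `Σ_{k≥3}(k−1)|J_k| ≤ ½|J₂|` (banks then retain
`≥ ⅛|J₂|`). [folklore] -/
theorem fwdBalance_nonneg (hneg : ∀ k, 2 ≤ k → J k ≤ 0) (hsum : Summable fun k : ℕ => (k : ℝ) * |J k|)
    (hdom : ∑' k : ℕ, (if 3 ≤ k then ((k : ℝ) - 1) * |J k| else 0) ≤ 1 / 2 * |J 2|)
    (hs : IsHaggSeq s) (m : ℤ) : 0 ≤ fwdBalance J s m := by
  have habs := ledger_summable_abs hsum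
  by_cases hb : IsCLayer s (m + 1)
  · have h1 := fwdBalance_bank_ge (hneg 2 le_rfl) habs hs hb
    have h2 := ledger_bank_sum_le hsum
    nlinarith [abs_nonneg (J 2)]
  · exact fwdBalance_nonneg_of_not_bank hneg habs hs hb

end Forward

end Summit.AtomisticToContinuum.Crystallization.Theorems.StrictSplittingRuleBirth

end
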